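import Mathlib.GroupTheory.SpecificGroups.Alternating
import Mathlib.SetTheory.Cardinal.Finite
import Literature.Combinatorics.Additive.TripleProductProperty
import Literature.Computability.AlgebraicComplexity.CohnUmansTPP
import HarnessLib

/-!
# Neumann's `⟨5,5,5⟩` TPP triple in `A₅`: `β(Alt(5)) ≥ 125`

Topic `Literature/Computability/AlgebraicComplexity` (group-theoretic matrix multiplication; companion of
`CohnUmansTPP.lean` (`RealizesTPP`), `TPPCapacitySL2Tables.lean` (the Hedtke–Murthy subgroup row `⟨12,3,3⟩` of
`A₅`) and `TPPFiveByFiveIndexTwo.lean` (Hart–Hedtke–Müller-Hannemann–Murthy, Thm. 3.7: no group of order `≤ 72`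
with an abelian index-`2` subgroup realizes `⟨5,5,5⟩`)).

P. M. Neumann, *A note on the triple product property for subsets of finite groups*, LMS J. Comput. Math. 14
(2011) 232–237, doi:10.1112/S1461157010000288. Read first-hand from the held text
`paper:neumann2011-note-triple-product-property-subsets-finite-groups`, p. 234 (PDF p. 3, L42–46), verbatim:

> *Examples.* It is easy to see from these inequalities that if `n = 60`, then `β(G) ⩽ 180`. There is a TPP
> triple with parameters `(5, 5, 5)` in the alternating group `Alt(5)`, namely
> `S₁ := ⟨(1 2 3 4 5)⟩, S₂ := ⟨(1 3 4 5 2)⟩, S₃ := ⟨(1 2 4)⟩ ∪ ⟨(3 4 5)⟩`,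
> and therefore `β(Alt(5)) ⩾ 125`. It would be interesting to know if there are triples with parameters
> `(6, 6, 4)`, `(6, 5, 5)`, or `(6, 6, 5)` in `Alt(5)` — or, indeed, in any other group of order `60`.

and p. 234–235 (PDF p. 3 L54 – p. 4 L3): "if `G` is a group that realises the parameter triple `(5, 5, 5)`, then
`n ⩾ 45`. […] Thus, the smallest `n` such that there is a group of order `n` realising the triple `(5, 5, 5)` is
one of `48, 52, 54, 55, 56, 57, 58`, and `60`. It could be quite interesting to pin it down precisely." (Hart et al.,
arXiv:1305.0448, §3.2, quote this example: "one of the C2 candidates, `A₅`, is already known ([Neumann2011]) to have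
a `⟨5,5,5⟩` triple".)

## What is formalized (all proved; `0 defs / 0 facts`)
With `Fin 5 = {0,…,4}` for Neumann's `{1,…,5}` (`i ↦ i − 1`): `p = (0 1 2 3 4)`, `q = (0 2 3 4 1)`, `c₁ = (0 1 3)`,
`c₂ = (2 3 4)` as products of transpositions, `S₁ = {pⁱ : i < 5}`, `S₂ = {qⁱ : i < 5}`,
`S₃ = {c₁ⁱ : i < 3} ∪ {c₂ⁱ : i < 3}` (the two `3`-cycles share only the identity, so `|S₃| = 5`; `S₃` is not a
subgroup).
* `Neumann2011_alt5_triple` — `(S₁, S₂, S₃)` has the triple product property (right-quotient form of the tree,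
  Neumann's own convention), `|S₁| = |S₂| = |S₃| = 5`, and all fifteen elements are even;
* `Neumann2011_alt5_realizes555` — `RealizesTPP (alternatingGroup (Fin 5)) 5 5 5`, `|A₅| = 60` (so
  `β(Alt(5)) ≥ 125 > |Alt(5)|`).
The kernel computation is organised as: carrier facts for the cyclic groups `S₁`, `S₂` (closed under products
and inverses), and the clause `a b (u u'⁻¹) = 1 ⇒ a = b = 1 ∧ u = u'` over `S₁ × S₂ × S₃ × S₃` (`625` cases),
which for product-closed `S₁, S₂` is the full TPP (`tpp_of_closed₁₂`, proved).

## References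
* P. M. Neumann, LMS J. Comput. Math. 14 (2011) 232–237: Examples after Observation 3.1, p. 234. [Neumann2011]
* S. Hart, I. Hedtke, M. Müller-Hannemann, S. Murthy, arXiv:1305.0448 (2013), §3.2 (the `A₅` remark). [HartEtAl2013]
* H. Cohn, C. Umans, FOCS 2003: Def. 2.1 (TPP). [CohnUmans2003]
-/

namespace Literature.Computability.AlgebraicComplexity

open Equiv Literature.Combinatorics.Additive

variable {G : Type*} [Group G]

/-- In a finite set in which every element has a right inverse inside the set, inverses stay inside. [folklore] -/
private theorem inv_mem_of_mul_eq_one' {X : Finset G} (hX : ∀ x ∈ X, ∃ y ∈ X, x * y = 1) {x : G} (hx : x ∈ X) :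
    x⁻¹ ∈ X := by
  obtain ⟨y, hy, hxy⟩ := hX x hx
  rw [inv_eq_of_mul_eq_one_right hxy]
  exact hy

/-- **Glue.** If `S` and `T` are closed under products and contain right inverses (so `Q(S) ⊆ S`, `Q(T) ⊆ T`),
then the clause "`a b (u u'⁻¹) = 1` with `a ∈ S`, `b ∈ T`, `u, u' ∈ U` forces `a = b = 1` and `u = u'`" is the triple
product property of `(S, T, U)` in right-quotient form. [folklore] -/
private theorem tpp_of_closed₁₂ {S T U : Finset G}
    (hmS : ∀ x ∈ S, ∀ y ∈ S, x * y ∈ S) (hiS : ∀ x ∈ S, ∃ y ∈ S, x * y = 1)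
    (hmT : ∀ x ∈ T, ∀ y ∈ T, x * y ∈ T) (hiT : ∀ x ∈ T, ∃ y ∈ T, x * y = 1)
    (hkey : ∀ a ∈ S, ∀ b ∈ T, ∀ u ∈ U, ∀ u' ∈ U, a * b * (u * u'⁻¹) = 1 → a = 1 ∧ b = 1 ∧ u = u') :
    TripleProductProperty S T U := by
  intro s hs s' hs' t ht t' ht' u hu u' hu' he
  obtain ⟨h1, h2, h3⟩ := hkey _ (hmS _ hs _ (inv_mem_of_mul_eq_one' hiS hs')) _
    (hmT _ ht _ (inv_mem_of_mul_eq_one' hiT ht')) u hu u' hu' he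
  exact ⟨mul_inv_eq_one.1 h1, mul_inv_eq_one.1 h2, h3⟩

/-- Transport into a subgroup `K`: a TPP triple of `G` all of whose members lie in `K` makes `K` (as a group)
realize `⟨|S|, |T|, |U|⟩`. [folklore] -/
private theorem realizesTPP_of_subset_subgroup [DecidableEq G] (K : Subgroup G) {S T U : Finset G}
    (hS : ∀ x ∈ S, x ∈ K) (hT : ∀ x ∈ T, x ∈ K) (hU : ∀ x ∈ U, x ∈ K) (h : TripleProductProperty S T U) :
    RealizesTPP K S.card T.card U.card := by
  classical
  have hinj : Function.Injective K.subtype := K.subtype_injective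
  refine ⟨S.preimage K.subtype hinj.injOn, T.preimage K.subtype hinj.injOn, U.preimage K.subtype hinj.injOn,
    ?_, ?_, ?_, ?_⟩
  · rw [Finset.card_preimage, Finset.filter_true_of_mem fun x hx => ⟨⟨x, hS x hx⟩, rfl⟩]
  · rw [Finset.card_preimage, Finset.filter_true_of_mem fun x hx => ⟨⟨x, hT x hx⟩, rfl⟩]
  · rw [Finset.card_preimage, Finset.filter_true_of_mem fun x hx => ⟨⟨x, hU x hx⟩, rfl⟩]
  · intro s hs s' hs' t ht t' ht' u hu u' hu' hrel
    simp only [Finset.mem_preimage] at hs hs' ht ht' hu hu'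
    have hrel' : (s : G) * (s' : G)⁻¹ * ((t : G) * (t' : G)⁻¹) * ((u : G) * (u' : G)⁻¹) = 1 := by
      simpa only [map_mul, map_inv, map_one, Subgroup.coe_subtype] using congrArg K.subtype hrel
    obtain ⟨e1, e2, e3⟩ := h _ hs _ hs' _ ht _ ht' _ hu _ hu' hrel'
    exact ⟨Subtype.ext e1, Subtype.ext e2, Subtype.ext e3⟩

/-- Carrier facts for `S₁ = ⟨(0 1 2 3 4)⟩ = {pⁱ : i < 5}` (kernel computation): size `5`, contains `1`, closed under
products, right inverses inside, all elements even. [cite: Neumann2011, Examples after Obs. 3.1, p. 234] -/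
private theorem factsS₁_alt5 :
    let p : Perm (Fin 5) := swap 0 1 * swap 1 2 * swap 2 3 * swap 3 4
    let X := (Finset.range 5).image (p ^ ·)
    X.card = 5 ∧ (1 : Perm (Fin 5)) ∈ X ∧ (∀ x ∈ X, ∀ y ∈ X, x * y ∈ X) ∧
      (∀ x ∈ X, ∃ y ∈ X, x * y = 1) ∧ (∀ x ∈ X, Perm.sign x = 1) := by
  decide +kernel

/-- Carrier facts for `S₂ = ⟨(0 2 3 4 1)⟩ = {qⁱ : i < 5}` (kernel computation): size `5`, contains `1`, closed under
products, right inverses inside, all elements even. [cite: Neumann2011, Examples after Obs. 3.1, p. 234] -/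
private theorem factsS₂_alt5 :
    let q : Perm (Fin 5) := swap 0 2 * swap 2 3 * swap 3 4 * swap 4 1
    let X := (Finset.range 5).image (q ^ ·)
    X.card = 5 ∧ (1 : Perm (Fin 5)) ∈ X ∧ (∀ x ∈ X, ∀ y ∈ X, x * y ∈ X) ∧
      (∀ x ∈ X, ∃ y ∈ X, x * y = 1) ∧ (∀ x ∈ X, Perm.sign x = 1) := by
  decide +kernel

/-- Facts for `S₃ = ⟨(0 1 3)⟩ ∪ ⟨(2 3 4)⟩` (kernel computation): size `5`, all elements even.
[cite: Neumann2011, Examples after Obs. 3.1, p. 234] -/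
private theorem factsS₃_alt5 :
    let c₁ : Perm (Fin 5) := swap 0 1 * swap 1 3
    let c₂ : Perm (Fin 5) := swap 2 3 * swap 3 4
    let X := (Finset.range 3).image (c₁ ^ ·) ∪ (Finset.range 3).image (c₂ ^ ·)
    X.card = 5 ∧ (∀ x ∈ X, Perm.sign x = 1) := by
  decide +kernel

/-- The key clause (kernel computation over `5⁴ = 625` quadruples): `a b (u u'⁻¹) = 1` with `a ∈ S₁`, `b ∈ S₂`,
`u, u' ∈ S₃` forces `a = b = 1` and `u = u'`. [cite: Neumann2011, Examples after Obs. 3.1, p. 234] -/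
private theorem key_alt5_555 :
    let p : Perm (Fin 5) := swap 0 1 * swap 1 2 * swap 2 3 * swap 3 4
    let q : Perm (Fin 5) := swap 0 2 * swap 2 3 * swap 3 4 * swap 4 1
    let c₁ : Perm (Fin 5) := swap 0 1 * swap 1 3
    let c₂ : Perm (Fin 5) := swap 2 3 * swap 3 4
    let S₁ := (Finset.range 5).image (p ^ ·)
    let S₂ := (Finset.range 5).image (q ^ ·)
    let S₃ := (Finset.range 3).image (c₁ ^ ·) ∪ (Finset.range 3).image (c₂ ^ ·)
    ∀ a ∈ S₁, ∀ b ∈ S₂, ∀ u ∈ S₃, ∀ u' ∈ S₃, a * b * (u * u'⁻¹) = 1 → a = 1 ∧ b = 1 ∧ u = u' := by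
  decide +kernel

/-- **Neumann 2011, the `⟨5,5,5⟩` triple of `Alt(5)`**: in `S₅ ⊇ A₅` the sets `S₁ = ⟨(0 1 2 3 4)⟩`,
`S₂ = ⟨(0 2 3 4 1)⟩`, `S₃ = ⟨(0 1 3)⟩ ∪ ⟨(2 3 4)⟩` (Neumann's `⟨(1 2 3 4 5)⟩, ⟨(1 3 4 5 2)⟩, ⟨(1 2 4)⟩ ∪ ⟨(3 4 5)⟩`
shifted to `{0,…,4}`) satisfy the triple product property, have `5` elements each, and consist of even
permutations. [cite: Neumann2011, Examples after Obs. 3.1, p. 234] -/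
theorem Neumann2011_alt5_triple :
    let p : Perm (Fin 5) := swap 0 1 * swap 1 2 * swap 2 3 * swap 3 4
    let q : Perm (Fin 5) := swap 0 2 * swap 2 3 * swap 3 4 * swap 4 1
    let c₁ : Perm (Fin 5) := swap 0 1 * swap 1 3
    let c₂ : Perm (Fin 5) := swap 2 3 * swap 3 4
    let S₁ := (Finset.range 5).image (p ^ ·)
    let S₂ := (Finset.range 5).image (q ^ ·)
    let S₃ := (Finset.range 3).image (c₁ ^ ·) ∪ (Finset.range 3).image (c₂ ^ ·)
    (TripleProductProperty S₁ S₂ S₃ ∧ S₁.card = 5 ∧ S₂.card = 5 ∧ S₃.card = 5) ∧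
      ((∀ g ∈ S₁, g ∈ alternatingGroup (Fin 5)) ∧ (∀ g ∈ S₂, g ∈ alternatingGroup (Fin 5)) ∧
        (∀ g ∈ S₃, g ∈ alternatingGroup (Fin 5))) := by
  obtain ⟨⟨c1, -, m1, i1, s1⟩, ⟨c2, -, m2, i2, s2⟩, ⟨c3, s3⟩, hkey⟩ :=
    (⟨factsS₁_alt5, factsS₂_alt5, factsS₃_alt5, key_alt5_555⟩ : _ ∧ _ ∧ _ ∧ _)
  exact ⟨⟨tpp_of_closed₁₂ m1 i1 m2 i2 hkey, c1, c2, c3⟩,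
    fun g hg => Perm.mem_alternatingGroup.mpr (s1 g hg), fun g hg => Perm.mem_alternatingGroup.mpr (s2 g hg),
    fun g hg => Perm.mem_alternatingGroup.mpr (s3 g hg)⟩

/-- **Neumann 2011: `A₅` realizes `⟨5,5,5⟩`, hence `β(Alt(5)) ≥ 125`** (with `|Alt(5)| = 60 < 125`).
[cite: Neumann2011, Examples after Obs. 3.1, p. 234] -/
theorem Neumann2011_alt5_realizes555 :
    RealizesTPP (alternatingGroup (Fin 5)) 5 5 5 ∧ Nat.card (alternatingGroup (Fin 5)) = 60 := by
  have hc : Nat.card (alternatingGroup (Fin 5)) = 60 := by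
    rw [nat_card_alternatingGroup]; simp [Nat.factorial]
  obtain ⟨⟨htpp, h1, h2, h3⟩, sS, sT, sU⟩ := Neumann2011_alt5_triple
  have h := realizesTPP_of_subset_subgroup (alternatingGroup (Fin 5)) sS sT sU htpp
  rw [h1, h2, h3] at h
  exact ⟨h, hc⟩

end Literature.Computability.AlgebraicComplexity
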